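import Summits.KontsevichZagierPeriods.KontsevichZagierPeriods.Theses.ScissorsAvatars
import Summits.KontsevichZagierPeriods.KontsevichZagierPeriods.Theorems.ScissorsAvatarsDivisibilityScissors
import Summits.KontsevichZagierPeriods.KontsevichZagierPeriods.Theorems.MzvKernelInKZTwoPosetsDefs
import Summits.KontsevichZagierPeriods.KontsevichZagierPeriods.Theorems.MzvKernelInKZTwoPosetsFurushoBridge
import Literature.NumberTheory.Transcendental.MZVSimplexRepProofs

/-!
# `MzvScissorsSector` (stmt-KontsevichZagierPeriods-4259, route ScissorsAvatars) — line `two-posets-scissors`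

Strategist line, lens TRANSFER (alternative to `Lines/birth.lean`; never touches it). The crux
(verbatim the route decl `…Theses.ScissorsAvatars.MzvScissorsSector`): for every weight `w` and every
`c` in the subgroup `Span_w` generated by the Kontsevich simplex representations `[mzvRep s]`
(`weight s = w`), `KZ.eval c = 0 → c ∈ C12 := closure (domainAddRel ∪ integrandAddRel ∪
changeOfVariablesRel)` (rules 1a, 1b, 2 only — no Newton–Leibniz).

THE SOLVED SIBLING AND ITS TRANSFER. The sibling crux `LinRedNormalForm.MzvKernelInKZ` (same sector,
Newton–Leibniz ALLOWED) is reduced IN THE TREE to three named inputs,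
`MzvKernelInKZ_of_furusho : HoffmanRelationInKZ → EdsComplete → HoffmanIndependent → MzvKernelInKZ`
(Theorems/LinRedNormalFormMzvKernelInKZ.lean), by the line `two-posets-interior-landen`, whose
calculus half is LANDED: the shuffle product is a dissection (`stub_shuffleProduct`: order cells of
`Δ_a × Δ_b`, rule 1a, + coordinate permutations, rule 2), the stuffle product is a partial-fraction
regrouping in cubical charts (`stuffleProductInKZ_of_tree`: monomial blow-ups, rule 2, + positive
three-term partial fractions, rule 1b), Hoffman's relation in depth one is the order-polytope /
interior-Landen chain (`stub_hoffmanDepthOne stub_cubicalChart stub_interiorLanden`: rules 1a, 1b, 2),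
duality is ONE rule-2 move (`Negative.duality_mem_changeOfVariablesRel`), and the
certificate-realisation engine `transferCore` turns the per-weight EDS certificates
(`TwoPosets.EdsCertificate`, kernel-checked in the tree for every weight up to 13, cf.
Theorems/LinRedNormalFormHoffmanSpanInKZEds1{0,1,2,3}*.lean, and `stub_edsCertificateLow` for `N ≤ 6`)
into Hoffman spanning modulo `KZ.relations`. NO FILE OF THAT LINE MENTIONS `newtonLeibnizRel` (the
move witnesses are rules 1a/1b/2 throughout), but every conclusion is typed `∈ KZ.relations`.
TRANSFER = re-target the same chains to `C12`, in the dimension `w` where they already live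
(`noStokes_locality`, Theorems/HoffmanRelationInKZ/Negative/NoStokesLocality.lean: an NL-free proof
is a chain in ONE dimension). The ONLY input that does not transfer from a landed proof is Hoffman's
relation in depth `≥ 2` (FurushoPentagon's crux `HoffmanRelationInKZ`, stmt-3930, open even with
Newton–Leibniz; every chain proposed there so far descends by a Newton–Leibniz step) — it is this
line's hardest structural stub, in the sharper `C12` form.

Stubs (6): `stub_shuffleScissors`, `stub_stuffleScissors`, `stub_hoffmanRelationScissors` (all
depths; depth one ports from the tree, depth ≥ 2 is the open core), `stub_edsComplete` (shared
combinatorial input, verbatim `TwoPosets.EdsComplete`), `stub_scissorsTransfer` (the realisation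
engine in `FormalRep ⧸ C12`: families + certificates ⇒ HOFFMAN NORMAL FORM INSIDE `C12`, which is
verbatim stub 1 of line `hoffman-scissors`), `stub_hoffmanIndependence` (the shared wall, verbatim
item stmt-15045). Composition (sorry-free): the engine's output + independence ⇒ crux, by the
coordinate/realisation argument on the free abelian group and INTEGER DIVISION IN `C12`
(landed item `DivisibilityScissors`, `ScissorsAvatars.divisibilityScissors_proof`).

Disproof used: none on file for this crux (no `Disproof.lean`, no `Theorems/MzvScissorsSector/Negative`).
Honoured from the sibling negatives: `Negative.Core.not_withoutEval` (eval enters only via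
independence), `withoutClosure_iff_summit` (everything restricted to the MZV span),
`StuffleInKZ.Negative.nlFreeRelations_le_ker_gradedEval` (graded evaluation, the only known invariant
of `C12`, vanishes on every stub's element: all are homogeneous of one dimension with value `0`),
`StuffleInKZ.Negative.gradedEval_defect` ("graded evaluation does NOT obstruct an NL-free chain for
the stuffle").
-/

set_option linter.dupNamespace false

noncomputable section

namespace Summit.KontsevichZagierPeriods.KontsevichZagierPeriods.Cruxes.MzvScissorsSector.TwoPosetsScissors

open Literature.NumberTheory.Transcendental
open Summit.KontsevichZagierPeriods.KontsevichZagierPeriods.Theses.ScissorsAvatars (MzvScissorsSector)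

/-! ## Stubs -/

/-- Stub 1 (SHUFFLE IS A DISSECTION, inside `C12`): for admissible words `ε`, `ε'` the product
representation `[Δ_a, ω_ε]·[Δ_b, ω_ε'] = [Δ_a × Δ_b, ω_ε ⊗ ω_ε']` (`KZ.of_mul_of`) differs from the sum
over the shuffles of the brackets `zWord` by an element of `C12`: rule 1a (the shuffle order-cells
cover `Δ_a × Δ_b` up to the null set of ties) and coordinate permutations (rule 2). The `C12`-retarget
of the LANDED sibling theorem `TwoPosets.stub_shuffleProduct` (`ShuffleProductInKZ`, conclusion in
`KZ.relations`). Why it might fail: only through bookkeeping — the landed proof's helper lemmas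
(`of_sub_of_mem_relations_of_eqOn`, null-set removal) conclude in `relations` and need `C12` twins
(integrand additivity against a zero representation; `σ = σ ∪ σ` for null `σ`). Sources:
Souderes2010 (arXiv:0808.0248) §1.2, IharaKanekoZagier2006 §1, KontsevichZagier2001 §1.2. -/
theorem stub_shuffleScissors : ∀ (a b : ℕ) (ε : Fin a → Bool) (ε' : Fin b → Bool) (hε : Summit.KontsevichZagierPeriods.MzvKernelInKZ.Negative.Adm ε) (hε' : Summit.KontsevichZagierPeriods.MzvKernelInKZ.Negative.Adm ε'), 0 < a → 0 < b → Literature.NumberTheory.Transcendental.KZ.of (Summit.KontsevichZagierPeriods.MzvKernelInKZ.Negative.wordRep ε 1 hε) * Literature.NumberTheory.Transcendental.KZ.of (Summit.KontsevichZagierPeriods.MzvKernelInKZ.Negative.wordRep ε' 1 hε') - ((Literature.NumberTheory.Transcendental.MZV.shuffleWord (List.ofFn ε) (List.ofFn ε')).map fun w => Summit.KontsevichZagierPeriods.MzvKernelInKZ.TwoPosets.zWord (a + b) (Summit.KontsevichZagierPeriods.MzvKernelInKZ.TwoPosets.wordOf (a + b) w) 1).sum ∈ AddSubgroup.closure (Literature.NumberTheory.Transcendental.KZ.domainAddRel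 ∪ Literature.NumberTheory.Transcendental.KZ.integrandAddRel ∪ Literature.NumberTheory.Transcendental.KZ.changeOfVariablesRel) := by
  sorry

/-- Stub 2 (STUFFLE IS A PARTIAL-FRACTION REGROUPING IN CUBICAL CHARTS, inside `C12`): for non-empty
admissible indices the product of the brackets differs from `Σ_{u ∈ s ∗ t} zIdx u 1` by an element
of `C12`: cubical (monomial) charts on both factors (rule 2, polynomial Jacobian), the positive
three-term identity `1/((1-A)(1-B)) = A/((1-A)(1-AB)) + B/((1-B)(1-AB)) + 1/(1-AB)` applied
recursively (rule 1b, all summands positive hence separately integrable), coordinate permutations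
and cubical charts back (rule 2). The `C12`-retarget of the LANDED `TwoPosets.stuffleProductInKZ_of_tree`
(from FurushoPentagon's `StuffleInKZ_of`); `StuffleInKZ.Negative.gradedEval_defect` records that the
only known `C12`-invariant does not obstruct it. Why it might fail: the landed chain may route a
normalisation through a helper that internally uses a Newton–Leibniz or Fubini step (to be audited
lemma by lemma when porting). Sources: Souderes2010 Prop 1.3/1.5 Cor 1.6, Hoffman1997,
KontsevichZagier2001 §1.2. -/
theorem stub_stuffleScissors : ∀ (s t : List ℕ) (hs : Literature.NumberTheory.Transcendental.MZV.IsAdmissible s) (ht : Literature.NumberTheory.Transcendental.MZV.IsAdmissible t), s ≠ [] → t ≠ [] → Summit.KontsevichZagierPeriods.MzvKernelInKZ.TwoPosets.zIdx s 1 * Summit.KontsevichZagierPeriods.MzvKernelInKZ.TwoPosets.zIdx t 1 - ((Literature.NumberTheory.Transcendental.MZV.stuffle s t).map fun u => Summit.KontsevichZagierPeriods.MzvKernelInKZ.TwoPosets.zIdx u 1).sum ∈ AddSubgroup.closure (Literature.NumberTheory.Transcendental.KZ.domainAddRel ∪ Literature.NumberTheory.Transcendental.KZ.integrandAddRel ∪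 Literature.NumberTheory.Transcendental.KZ.changeOfVariablesRel) := by
  sorry

/-- Stub 3 (HOFFMAN'S RELATION INSIDE `C12`, all depths; Hoffman 1992 Thm 5.1 in the tree's indexing
of `hoffman_relation` / `TwoPosets.HoffmanDeepInKZ`): for admissible `s`,
`Σ_l [ζ(s₁,…,s_l+1,…)] − Σ_l Σ_{j<s_l−1} [ζ(s₁,…,s_l−j, j+1,…)] ∈ C12` (for `s = []` both sums are
empty; `s = (2)` is duality `ζ(3) = ζ(2,1)`, one rule-2 move). DEPTH ONE (`s = (k)`, Euler's sum
formula) ports from the LANDED interior-Landen chain of the sibling (order polytope dissection 1a,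
forest chart 2, `E′` = five moves `s = r/v`, Möbius involution, `ρ = vr`, two positive partial
fractions, then one partial fraction and two cubical charts — rules 1a/1b/2 only). DEPTH ≥ 2 is the
OPEN CORE: FurushoPentagon's crux `HoffmanRelationInKZ` (stmt-3930) even with Newton–Leibniz, here in
the sharper fixed-dimension form. Why it might fail: every chain proposed so far for deep Hoffman
relations introduces a variable and descends by Newton–Leibniz (`noStokes_locality` says an NL-free
proof must stay in dimension `w`); Kaneko–Yamamoto's integral-series identity gives 2-poset
DISSECTIONS for products but the regularised term may need Stokes. Sources: Hoffman1992 Thm 5.1,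
KanekoYamamoto2018 Thm 4.1, IharaKanekoZagier2006 §1, BrownCarrSchneps2010 §2. -/
theorem stub_hoffmanRelationScissors : ∀ (s : List ℕ), Literature.NumberTheory.Transcendental.MZV.IsAdmissible s → (∑ l : Fin s.length, Summit.KontsevichZagierPeriods.MzvKernelInKZ.TwoPosets.zIdx (s.take l.1 ++ [s.get l + 1] ++ s.drop (l.1 + 1)) 1) - (∑ l : Fin s.length, ∑ j ∈ Finset.range (s.get l - 1), Summit.KontsevichZagierPeriods.MzvKernelInKZ.TwoPosets.zIdx (s.take l.1 ++ [s.get l - j, j + 1] ++ s.drop (l.1 + 1)) 1) ∈ AddSubgroup.closure (Literature.NumberTheory.Transcendental.KZ.domainAddRel ∪ Literature.NumberTheory.Transcendental.KZ.integrandAddRel ∪ Literature.NumberTheory.Transcendental.KZ.changeOfVariablesRel) := by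
  sorry

/-- Stub 4 (EDS CERTIFICATES IN EVERY WEIGHT — shared combinatorial input, verbatim
`TwoPosets.EdsComplete`): every admissible word of weight `N` is a rational combination of Hoffman
words plus finite-double-shuffle, Hoffman-relation and duality vectors. Decidable per weight and
kernel-checked in the tree for small weights (`stub_edsCertificateLow`, `N ≤ 6`; the
LinRedNormalForm certificate tables through weight 13); for all `N` it is Ihara–Kaneko–Zagier's
Conjecture 1 with Zagier's dimension count. Why it might fail: some weight may need a relation outside
finite double shuffle + Hoffman + duality (none found to weight ≈ 20 by exact rank computations).
Sources: IharaKanekoZagier2006 Conj. 1, Hoffman1997, KanekoNoroTsurumaki2008, Brown2012. -/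
theorem stub_edsComplete : Summit.KontsevichZagierPeriods.MzvKernelInKZ.TwoPosets.EdsComplete := by
  sorry

/-- Stub 5 (THE SCISSORS TRANSFER ENGINE — realisation in `FormalRep ⧸ C12`): shuffle-in-`C12` →
stuffle-in-`C12` → Hoffman-in-`C12` → EDS certificates → HOFFMAN NORMAL FORM INSIDE `C12` on the
simplex span (verbatim stub 1 of line `hoffman-scissors`: `∀ w, ∀ c ∈ Span_w, ∃ N > 0, ∃ h ∈
HoffSpan_w, N • c − h ∈ C12`). The `C12` twin of the LANDED engine `TwoPosets.transferCore` /
`stub_realisation`: the realisation map `Vec N → FormalRep ⧸ C12` is additive and `ℚ`-compatible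
through the descended scaling (`KZ.scale` preserves `C12`: `ScissorsAvatars.scale_mem_closure₁₂`),
duality vectors realise to `0` (`Negative.duality_mem_changeOfVariablesRel ⊆ C12`), the finite double
shuffle vector is (shuffle − product) − (stuffle − product) so the product CANCELS, brackets are the
simplex generators (`TwoPosets.zIdx_one_eq_of_mzvRep`), denominators are cleared by `N •` and
integrand additivity (`KZ.IntegralRep.of_constMul_nat_sub_nsmul_mem`), and the closure induction
from generators to `Span_w` multiplies the `N`'s. Why it might fail: cost, not doubt — pure
bookkeeping over the free abelian group (≈ the 400 lines of the sibling's Transfer file).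
Sources: KontsevichZagier2001 §1.2, IharaKanekoZagier2006 §1, tree: MzvKernelInKZTwoPosetsTransfer. -/
theorem stub_scissorsTransfer : (∀ (a b : ℕ) (ε : Fin a → Bool) (ε' : Fin b → Bool) (hε : Summit.KontsevichZagierPeriods.MzvKernelInKZ.Negative.Adm ε) (hε' : Summit.KontsevichZagierPeriods.MzvKernelInKZ.Negative.Adm ε'), 0 < a → 0 < b → Literature.NumberTheory.Transcendental.KZ.of (Summit.KontsevichZagierPeriods.MzvKernelInKZ.Negative.wordRep ε 1 hε) * Literature.NumberTheory.Transcendental.KZ.of (Summit.KontsevichZagierPeriods.MzvKernelInKZ.Negative.wordRep ε' 1 hε') - ((Literature.NumberTheory.Transcendental.MZV.shuffleWord (List.ofFn ε) (List.ofFn ε')).map fun w => Summit.KontsevichZagierPeriods.MzvKernelInKZ.TwoPosets.zWord (a + b) (Summit.KontsevichZagierPeriods.MzvKernelInKZ.TwoPosets.wordOf (a + b) w) 1).sum ∈ AddSubgroup.closure (Literature.NumberTheory.Transcendental.KZ.domainAddRel ∪ Literature.NumberTheory.Transcendental.KZ.integrandAddRel ∪ Literature.NumberTheory.Transcendental.KZ.changeOfVariablesRel))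 → (∀ (s t : List ℕ) (hs : Literature.NumberTheory.Transcendental.MZV.IsAdmissible s) (ht : Literature.NumberTheory.Transcendental.MZV.IsAdmissible t), s ≠ [] → t ≠ [] → Summit.KontsevichZagierPeriods.MzvKernelInKZ.TwoPosets.zIdx s 1 * Summit.KontsevichZagierPeriods.MzvKernelInKZ.TwoPosets.zIdx t 1 - ((Literature.NumberTheory.Transcendental.MZV.stuffle s t).map fun u => Summit.KontsevichZagierPeriods.MzvKernelInKZ.TwoPosets.zIdx u 1).sum ∈ AddSubgroup.closure (Literature.NumberTheory.Transcendental.KZ.domainAddRel ∪ Literature.NumberTheory.Transcendental.KZ.integrandAddRel ∪ Literature.NumberTheory.Transcendental.KZ.changeOfVariablesRel)) → (∀ (s : List ℕ), Literature.NumberTheory.Transcendental.MZV.IsAdmissible s → (∑ l : Fin s.length, Summit.KontsevichZagierPeriods.MzvKernelInKZ.TwoPosets.zIdx (s.take l.1 ++ [s.get l + 1] ++ s.drop (l.1 + 1)) 1) - (∑ l : Fin s.length, ∑ j ∈ Finset.range (s.get l - 1), Summit.KontsevichZagierPeriods.MzvKernelInKZ.TwoPosets.zIdx (s.take l.1 ++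 [s.get l - j, j + 1] ++ s.drop (l.1 + 1)) 1) ∈ AddSubgroup.closure (Literature.NumberTheory.Transcendental.KZ.domainAddRel ∪ Literature.NumberTheory.Transcendental.KZ.integrandAddRel ∪ Literature.NumberTheory.Transcendental.KZ.changeOfVariablesRel)) → Summit.KontsevichZagierPeriods.MzvKernelInKZ.TwoPosets.EdsComplete → ∀ (w : ℕ) (c : Literature.NumberTheory.Transcendental.KZ.FormalRep), c ∈ AddSubgroup.closure {x : Literature.NumberTheory.Transcendental.KZ.FormalRep | ∃ (s : List ℕ) (hs : Literature.NumberTheory.Transcendental.MZV.IsAdmissible s), Literature.NumberTheory.Transcendental.MZV.weight s = w ∧ x = Literature.NumberTheory.Transcendental.KZ.of (Literature.NumberTheory.Transcendental.KZ.mzvRep s hs (Literature.NumberTheory.Transcendental.KZ.mzvIntegrand_isSemialgebraicFunOn_holds s) (Literature.NumberTheory.Transcendental.KZ.mzvIntegrand_integrableOn_holds s hs))} → ∃ (N : ℕ) (h : Literature.NumberTheory.Transcendental.KZ.FormalRep), 0 < N ∧ h ∈ AddSubgroup.closure {x : Literature.NumberTheory.Transcendental.KZ.FormalRep | ∃ (s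 : List ℕ) (hs : Literature.NumberTheory.Transcendental.MZV.IsAdmissible s), Literature.NumberTheory.Transcendental.MZV.IsHoffman s ∧ Literature.NumberTheory.Transcendental.MZV.weight s = w ∧ x = Literature.NumberTheory.Transcendental.KZ.of (Literature.NumberTheory.Transcendental.KZ.mzvRep s hs (Literature.NumberTheory.Transcendental.KZ.mzvIntegrand_isSemialgebraicFunOn_holds s) (Literature.NumberTheory.Transcendental.KZ.mzvIntegrand_integrableOn_holds s hs))} ∧ N • c - h ∈ AddSubgroup.closure (Literature.NumberTheory.Transcendental.KZ.domainAddRel ∪ Literature.NumberTheory.Transcendental.KZ.integrandAddRel ∪ Literature.NumberTheory.Transcendental.KZ.changeOfVariablesRel) := by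
  sorry

/-- Stub 6 (HOFFMAN INDEPENDENCE — the declared, shared transcendence input, verbatim route
LinRedNormalForm's item stmt-KontsevichZagierPeriods-15045 and `TwoPosets.HoffmanIndependent`): the
real Hoffman values are `ℚ`-linearly independent; with Brown's theorem (`hoffmanSpan_eq_mzvSpace`) it
is Zagier's conjecture. Why it might fail: fails iff ONE `ℚ`-linear relation among real Hoffman MZVs
exists (none known or expected); unreachable by present transcendence methods. Sources: Zagier1994 §9,
Brown2012 Thm 1.1, Hoffman1997, GoncharovECM2001 Conj. 1.1. -/
theorem stub_hoffmanIndependence : LinearIndependent ℚ (fun u : {u : List ℕ // Literature.NumberTheory.Transcendental.MZV.IsHoffman u} => Literature.NumberTheory.Transcendental.multipleZeta u.1) := by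
  sorry

/-! ## Coordinates on the Hoffman span (sorry-free bookkeeping, as in line `hoffman-scissors`) -/

/-- Hoffman indices. [folklore] -/
abbrev HIdx : Type := {u : List ℕ // MZV.IsHoffman u}

/-- The simplex-representation generator `[mzvRep u]` of a Hoffman index. [folklore] -/
def ofH (u : HIdx) : KZ.FormalRep :=
  KZ.of (KZ.mzvRep u.1 u.2.isAdmissible (KZ.mzvIntegrand_isSemialgebraicFunOn_holds u.1)
    (KZ.mzvIntegrand_integrableOn_holds u.1 u.2.isAdmissible))

open scoped Classical in
/-- Coordinates: a generator which IS a Hoffman generator `ofH u` goes to `single u 1` (for a CHOSEN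
such `u`), every other generator to `0`. [folklore] -/
def coord : KZ.FormalRep →+ (HIdx →₀ ℤ) :=
  FreeAbelianGroup.lift fun p =>
    if h : ∃ u : HIdx, FreeAbelianGroup.of p = ofH u then Finsupp.single h.choose 1 else 0

/-- Realisation of integer coordinate vectors: `f ↦ Σ_u f u • [mzvRep u]`. [folklore] -/
def realise : (HIdx →₀ ℤ) →+ KZ.FormalRep :=
  Finsupp.liftAddHom fun u => zmultiplesHom KZ.FormalRep (ofH u)

/-- `realise (single u n) = n • [mzvRep u]`. [folklore] -/
theorem realise_single (u : HIdx) (n : ℤ) : realise (Finsupp.single u n) = n • ofH u := by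
  simp [realise]

/-- On a Hoffman generator, `realise ∘ coord` is the identity. [folklore] -/
theorem realise_coord_ofH (u : HIdx) : realise (coord (ofH u)) = ofH u := by
  have hex : ∃ v : HIdx, ofH u = ofH v := ⟨u, rfl⟩
  have hc : coord (ofH u) = Finsupp.single hex.choose 1 := by
    show FreeAbelianGroup.lift _ (FreeAbelianGroup.of _) = _
    rw [FreeAbelianGroup.lift_apply_of]
    exact dif_pos hex
  rw [hc, realise_single, one_zsmul]
  exact hex.choose_spec.symm

/-- On the subgroup generated by the weight-`w` Hoffman simplex representations, `realise ∘ coord`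
is the identity. [folklore] -/
theorem realise_coord_eq {w : ℕ} {h : KZ.FormalRep}
    (hh : h ∈ AddSubgroup.closure {x : KZ.FormalRep | ∃ (s : List ℕ) (hs : MZV.IsAdmissible s),
      MZV.IsHoffman s ∧ MZV.weight s = w ∧ x = KZ.of (KZ.mzvRep s hs
        (KZ.mzvIntegrand_isSemialgebraicFunOn_holds s) (KZ.mzvIntegrand_integrableOn_holds s hs))}) :
    realise (coord h) = h := by
  refine AddSubgroup.closure_induction (fun x hx => ?_) ?_ (fun x y _ _ hx hy => ?_)
    (fun x _ hx => ?_) hh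
  · obtain ⟨s, hs, hH, -, rfl⟩ := hx
    exact realise_coord_ofH ⟨s, hH⟩
  · simp
  · rw [map_add, map_add, hx, hy]
  · rw [map_neg, map_neg, hx]

/-- Evaluation of a realised coordinate vector (Kontsevich's formula `KZ.mzvRep_value_holds`).
[cite: KontsevichZagier2001, §1.1] -/
theorem eval_realise (f : HIdx →₀ ℤ) :
    KZ.eval (realise f) = f.sum fun u n => n • multipleZeta u.1 := by
  rw [realise, Finsupp.liftAddHom_apply, map_finsuppSum]
  refine Finsupp.sum_congr fun u _ => ?_
  rw [zmultiplesHom_apply, map_zsmul, ofH, KZ.eval_of, KZ.mzvRep_value_holds]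

/-- Hoffman independence in `FormalRep` terms: an `h` in the Hoffman span with `eval h = 0` is `0`. [folklore] -/
theorem hoffSpan_eq_zero_of_eval_eq_zero
    (hI : LinearIndependent ℚ (fun u : {u : List ℕ // MZV.IsHoffman u} => multipleZeta u.1))
    {w : ℕ} {h : KZ.FormalRep}
    (hh : h ∈ AddSubgroup.closure {x : KZ.FormalRep | ∃ (s : List ℕ) (hs : MZV.IsAdmissible s),
      MZV.IsHoffman s ∧ MZV.weight s = w ∧ x = KZ.of (KZ.mzvRep s hs
        (KZ.mzvIntegrand_isSemialgebraicFunOn_holds s) (KZ.mzvIntegrand_integrableOn_holds s hs))})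
    (h0 : KZ.eval h = 0) : h = 0 := by
  set f : HIdx →₀ ℤ := coord h with hf
  have hreal : realise f = h := realise_coord_eq hh
  set l : HIdx →₀ ℚ := Finsupp.mapRange (Int.cast : ℤ → ℚ) (by simp) f with hl
  have hcomb : Finsupp.linearCombination ℚ
      (fun u : {u : List ℕ // MZV.IsHoffman u} => multipleZeta u.1) l = 0 := by
    rw [Finsupp.linearCombination_apply, hl,
      Finsupp.sum_mapRange_index (h := fun (i : HIdx) (a : ℚ) => a • multipleZeta i.1)
        (fun _ => zero_smul _ _)]
    have : (f.sum fun u (n : ℤ) => (n : ℚ) • multipleZeta u.1) = f.sum fun u n => n • multipleZeta u.1 :=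
      Finsupp.sum_congr fun u _ => Int.cast_smul_eq_zsmul ℚ _ _
    rw [this, ← eval_realise, hreal, h0]
  have hl0 : l = 0 := linearIndependent_iff.mp hI l hcomb
  have hf0 : f = 0 := by
    have hinj := Finsupp.mapRange_injective (Int.cast : ℤ → ℚ) (by simp) Int.cast_injective
      (α := HIdx)
    apply hinj
    rw [← hl, hl0, Finsupp.mapRange_zero]
  rw [← hreal, hf0, map_zero]

/-! ## The composition (sorry-free) -/

/-- Hoffman normal form inside `C12` + Hoffman independence ⇒ the crux (soundness, coordinates,
integer division in `C12`). [folklore] -/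
theorem MzvScissorsSector_of_span_of_independent :
    (∀ (w : ℕ) (c : Literature.NumberTheory.Transcendental.KZ.FormalRep), c ∈ AddSubgroup.closure {x : Literature.NumberTheory.Transcendental.KZ.FormalRep | ∃ (s : List ℕ) (hs : Literature.NumberTheory.Transcendental.MZV.IsAdmissible s), Literature.NumberTheory.Transcendental.MZV.weight s = w ∧ x = Literature.NumberTheory.Transcendental.KZ.of (Literature.NumberTheory.Transcendental.KZ.mzvRep s hs (Literature.NumberTheory.Transcendental.KZ.mzvIntegrand_isSemialgebraicFunOn_holds s) (Literature.NumberTheory.Transcendental.KZ.mzvIntegrand_integrableOn_holds s hs))} → ∃ (N : ℕ) (h : Literature.NumberTheory.Transcendental.KZ.FormalRep), 0 < N ∧ h ∈ AddSubgroup.closure {x : Literature.NumberTheory.Transcendental.KZ.FormalRep | ∃ (s : List ℕ) (hs : Literature.NumberTheory.Transcendental.MZV.IsAdmissible s), Literature.NumberTheory.Transcendental.MZV.IsHoffman s ∧ Literature.NumberTheory.Transcendental.MZV.weight s = w ∧ x = Literature.NumberTheory.Transcendental.KZ.of (Literature.NumberTheory.Transcendental.KZ.mzvRep s hs (Literature.NumberTheory.Transcendental.KZ.mzvIntegrand_isSemialgebraicFunOn_holds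 s) (Literature.NumberTheory.Transcendental.KZ.mzvIntegrand_integrableOn_holds s hs))} ∧ N • c - h ∈ AddSubgroup.closure (Literature.NumberTheory.Transcendental.KZ.domainAddRel ∪ Literature.NumberTheory.Transcendental.KZ.integrandAddRel ∪ Literature.NumberTheory.Transcendental.KZ.changeOfVariablesRel)) → LinearIndependent ℚ (fun u : {u : List ℕ // Literature.NumberTheory.Transcendental.MZV.IsHoffman u} => Literature.NumberTheory.Transcendental.multipleZeta u.1) → MzvScissorsSector := by
  intro hS hI w c hc hc0
  obtain ⟨N, h, hN, hh, h12⟩ := hS w c hc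
  have hrel : N • c - h ∈ KZ.relations := AddSubgroup.closure_mono Set.subset_union_left h12
  have hker : KZ.eval (N • c - h) = 0 := AddMonoidHom.mem_ker.1 (KZ.relations_le_ker_eval_holds hrel)
  have hh0 : KZ.eval h = 0 := by
    rw [map_sub, map_nsmul, hc0, smul_zero, zero_sub, neg_eq_zero] at hker
    exact hker
  have h0 : h = 0 := hoffSpan_eq_zero_of_eval_eq_zero hI hh hh0
  rw [h0, sub_zero] at h12
  exact Summit.KontsevichZagierPeriods.ScissorsAvatars.divisibilityScissors_proof c N hN h12

/-- **Skeleton theorem, arrow form** (concludes the crux BY NAME): shuffle-in-`C12` →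
stuffle-in-`C12` → Hoffman's-relation-in-`C12` → EDS certificates → the scissors transfer engine →
Hoffman independence → `MzvScissorsSector`. [folklore] -/
theorem MzvScissorsSector_of :
    (∀ (a b : ℕ) (ε : Fin a → Bool) (ε' : Fin b → Bool) (hε : Summit.KontsevichZagierPeriods.MzvKernelInKZ.Negative.Adm ε) (hε' : Summit.KontsevichZagierPeriods.MzvKernelInKZ.Negative.Adm ε'), 0 < a → 0 < b → Literature.NumberTheory.Transcendental.KZ.of (Summit.KontsevichZagierPeriods.MzvKernelInKZ.Negative.wordRep ε 1 hε) * Literature.NumberTheory.Transcendental.KZ.of (Summit.KontsevichZagierPeriods.MzvKernelInKZ.Negative.wordRep ε' 1 hε') - ((Literature.NumberTheory.Transcendental.MZV.shuffleWord (List.ofFn ε) (List.ofFn ε')).map fun w => Summit.KontsevichZagierPeriods.MzvKernelInKZ.TwoPosets.zWord (a + b) (Summit.KontsevichZagierPeriods.MzvKernelInKZ.TwoPosets.wordOf (a + b) w) 1).sum ∈ AddSubgroup.closure (Literature.NumberTheory.Transcendental.KZ.domainAddRel ∪ Literature.NumberTheory.Transcendental.KZ.integrandAddRel ∪ Literature.NumberTheory.Transcendental.KZ.changeOfVariablesRel))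 →
    (∀ (s t : List ℕ) (hs : Literature.NumberTheory.Transcendental.MZV.IsAdmissible s) (ht : Literature.NumberTheory.Transcendental.MZV.IsAdmissible t), s ≠ [] → t ≠ [] → Summit.KontsevichZagierPeriods.MzvKernelInKZ.TwoPosets.zIdx s 1 * Summit.KontsevichZagierPeriods.MzvKernelInKZ.TwoPosets.zIdx t 1 - ((Literature.NumberTheory.Transcendental.MZV.stuffle s t).map fun u => Summit.KontsevichZagierPeriods.MzvKernelInKZ.TwoPosets.zIdx u 1).sum ∈ AddSubgroup.closure (Literature.NumberTheory.Transcendental.KZ.domainAddRel ∪ Literature.NumberTheory.Transcendental.KZ.integrandAddRel ∪ Literature.NumberTheory.Transcendental.KZ.changeOfVariablesRel)) →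
    (∀ (s : List ℕ), Literature.NumberTheory.Transcendental.MZV.IsAdmissible s → (∑ l : Fin s.length, Summit.KontsevichZagierPeriods.MzvKernelInKZ.TwoPosets.zIdx (s.take l.1 ++ [s.get l + 1] ++ s.drop (l.1 + 1)) 1) - (∑ l : Fin s.length, ∑ j ∈ Finset.range (s.get l - 1), Summit.KontsevichZagierPeriods.MzvKernelInKZ.TwoPosets.zIdx (s.take l.1 ++ [s.get l - j, j + 1] ++ s.drop (l.1 + 1)) 1) ∈ AddSubgroup.closure (Literature.NumberTheory.Transcendental.KZ.domainAddRel ∪ Literature.NumberTheory.Transcendental.KZ.integrandAddRel ∪ Literature.NumberTheory.Transcendental.KZ.changeOfVariablesRel)) →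
    Summit.KontsevichZagierPeriods.MzvKernelInKZ.TwoPosets.EdsComplete →
    ((∀ (a b : ℕ) (ε : Fin a → Bool) (ε' : Fin b → Bool) (hε : Summit.KontsevichZagierPeriods.MzvKernelInKZ.Negative.Adm ε) (hε' : Summit.KontsevichZagierPeriods.MzvKernelInKZ.Negative.Adm ε'), 0 < a → 0 < b → Literature.NumberTheory.Transcendental.KZ.of (Summit.KontsevichZagierPeriods.MzvKernelInKZ.Negative.wordRep ε 1 hε) * Literature.NumberTheory.Transcendental.KZ.of (Summit.KontsevichZagierPeriods.MzvKernelInKZ.Negative.wordRep ε' 1 hε') - ((Literature.NumberTheory.Transcendental.MZV.shuffleWord (List.ofFn ε) (List.ofFn ε')).map fun w => Summit.KontsevichZagierPeriods.MzvKernelInKZ.TwoPosets.zWord (a + b) (Summit.KontsevichZagierPeriods.MzvKernelInKZ.TwoPosets.wordOf (a + b) w) 1).sum ∈ AddSubgroup.closure (Literature.NumberTheory.Transcendental.KZ.domainAddRel ∪ Literature.NumberTheory.Transcendental.KZ.integrandAddRel ∪ Literature.NumberTheory.Transcendental.KZ.changeOfVariablesRel)) → (∀ (s t : List ℕ) (hs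 : Literature.NumberTheory.Transcendental.MZV.IsAdmissible s) (ht : Literature.NumberTheory.Transcendental.MZV.IsAdmissible t), s ≠ [] → t ≠ [] → Summit.KontsevichZagierPeriods.MzvKernelInKZ.TwoPosets.zIdx s 1 * Summit.KontsevichZagierPeriods.MzvKernelInKZ.TwoPosets.zIdx t 1 - ((Literature.NumberTheory.Transcendental.MZV.stuffle s t).map fun u => Summit.KontsevichZagierPeriods.MzvKernelInKZ.TwoPosets.zIdx u 1).sum ∈ AddSubgroup.closure (Literature.NumberTheory.Transcendental.KZ.domainAddRel ∪ Literature.NumberTheory.Transcendental.KZ.integrandAddRel ∪ Literature.NumberTheory.Transcendental.KZ.changeOfVariablesRel)) → (∀ (s : List ℕ), Literature.NumberTheory.Transcendental.MZV.IsAdmissible s → (∑ l : Fin s.length, Summit.KontsevichZagierPeriods.MzvKernelInKZ.TwoPosets.zIdx (s.take l.1 ++ [s.get l + 1] ++ s.drop (l.1 + 1)) 1) - (∑ l : Fin s.length, ∑ j ∈ Finset.range (s.get l - 1), Summit.KontsevichZagierPeriods.MzvKernelInKZ.TwoPosets.zIdx (s.take l.1 ++ [s.get l - j, j + 1] ++ s.drop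 (l.1 + 1)) 1) ∈ AddSubgroup.closure (Literature.NumberTheory.Transcendental.KZ.domainAddRel ∪ Literature.NumberTheory.Transcendental.KZ.integrandAddRel ∪ Literature.NumberTheory.Transcendental.KZ.changeOfVariablesRel)) → Summit.KontsevichZagierPeriods.MzvKernelInKZ.TwoPosets.EdsComplete → ∀ (w : ℕ) (c : Literature.NumberTheory.Transcendental.KZ.FormalRep), c ∈ AddSubgroup.closure {x : Literature.NumberTheory.Transcendental.KZ.FormalRep | ∃ (s : List ℕ) (hs : Literature.NumberTheory.Transcendental.MZV.IsAdmissible s), Literature.NumberTheory.Transcendental.MZV.weight s = w ∧ x = Literature.NumberTheory.Transcendental.KZ.of (Literature.NumberTheory.Transcendental.KZ.mzvRep s hs (Literature.NumberTheory.Transcendental.KZ.mzvIntegrand_isSemialgebraicFunOn_holds s) (Literature.NumberTheory.Transcendental.KZ.mzvIntegrand_integrableOn_holds s hs))} → ∃ (N : ℕ) (h : Literature.NumberTheory.Transcendental.KZ.FormalRep), 0 < N ∧ h ∈ AddSubgroup.closure {x : Literature.NumberTheory.Transcendental.KZ.FormalRep | ∃ (s : List ℕ) (hs : Literature.NumberTheory.Transcendental.MZV.IsAdmissible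 s), Literature.NumberTheory.Transcendental.MZV.IsHoffman s ∧ Literature.NumberTheory.Transcendental.MZV.weight s = w ∧ x = Literature.NumberTheory.Transcendental.KZ.of (Literature.NumberTheory.Transcendental.KZ.mzvRep s hs (Literature.NumberTheory.Transcendental.KZ.mzvIntegrand_isSemialgebraicFunOn_holds s) (Literature.NumberTheory.Transcendental.KZ.mzvIntegrand_integrableOn_holds s hs))} ∧ N • c - h ∈ AddSubgroup.closure (Literature.NumberTheory.Transcendental.KZ.domainAddRel ∪ Literature.NumberTheory.Transcendental.KZ.integrandAddRel ∪ Literature.NumberTheory.Transcendental.KZ.changeOfVariablesRel)) →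
    LinearIndependent ℚ (fun u : {u : List ℕ // Literature.NumberTheory.Transcendental.MZV.IsHoffman u} => Literature.NumberTheory.Transcendental.multipleZeta u.1) →
    MzvScissorsSector :=
  fun hSh hSt hH hE hT hI => MzvScissorsSector_of_span_of_independent (hT hSh hSt hH hE) hI

/-- **Skeleton theorem, by name**: `MzvScissorsSector` from the six declared stubs. -/
theorem MzvScissorsSector_skeleton : MzvScissorsSector :=
  MzvScissorsSector_of stub_shuffleScissors stub_stuffleScissors stub_hoffmanRelationScissors
    stub_edsComplete stub_scissorsTransfer stub_hoffmanIndependence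

/-! ## Sanity ties to the sibling (sorry-free): this line's structural stubs SHARPEN the sibling's -/

/-- Stub 1 implies the sibling's landed `ShuffleProductInKZ` statement (`C12 ⊆ relations`). [folklore] -/
theorem shuffleProductInKZ_of_stub (h : ∀ (a b : ℕ) (ε : Fin a → Bool) (ε' : Fin b → Bool) (hε : Summit.KontsevichZagierPeriods.MzvKernelInKZ.Negative.Adm ε) (hε' : Summit.KontsevichZagierPeriods.MzvKernelInKZ.Negative.Adm ε'), 0 < a → 0 < b → Literature.NumberTheory.Transcendental.KZ.of (Summit.KontsevichZagierPeriods.MzvKernelInKZ.Negative.wordRep ε 1 hε) * Literature.NumberTheory.Transcendental.KZ.of (Summit.KontsevichZagierPeriods.MzvKernelInKZ.Negative.wordRep ε' 1 hε') - ((Literature.NumberTheory.Transcendental.MZV.shuffleWord (List.ofFn ε) (List.ofFn ε')).map fun w => Summit.KontsevichZagierPeriods.MzvKernelInKZ.TwoPosets.zWord (a + b) (Summit.KontsevichZagierPeriods.MzvKernelInKZ.TwoPosets.wordOf (a + b) w) 1).sum ∈ AddSubgroup.closure (Literature.NumberTheory.Transcendental.KZ.domainAddRel ∪ Literature.NumberTheory.Transcendental.KZ.integrandAddRel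 ∪ Literature.NumberTheory.Transcendental.KZ.changeOfVariablesRel)) :
    Summit.KontsevichZagierPeriods.MzvKernelInKZ.TwoPosets.ShuffleProductInKZ :=
  fun a b ε ε' hε hε' ha hb => AddSubgroup.closure_mono Set.subset_union_left (h a b ε ε' hε hε' ha hb)

/-- Stub 2 implies the sibling's `StuffleProductInKZ` statement. [folklore] -/
theorem stuffleProductInKZ_of_stub (h : ∀ (s t : List ℕ) (hs : Literature.NumberTheory.Transcendental.MZV.IsAdmissible s) (ht : Literature.NumberTheory.Transcendental.MZV.IsAdmissible t), s ≠ [] → t ≠ [] → Summit.KontsevichZagierPeriods.MzvKernelInKZ.TwoPosets.zIdx s 1 * Summit.KontsevichZagierPeriods.MzvKernelInKZ.TwoPosets.zIdx t 1 - ((Literature.NumberTheory.Transcendental.MZV.stuffle s t).map fun u => Summit.KontsevichZagierPeriods.MzvKernelInKZ.TwoPosets.zIdx u 1).sum ∈ AddSubgroup.closure (Literature.NumberTheory.Transcendental.KZ.domainAddRel ∪ Literature.NumberTheory.Transcendental.KZ.integrandAddRel ∪ Literature.NumberTheory.Transcendental.KZ.changeOfVariablesRel)) :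
    Summit.KontsevichZagierPeriods.MzvKernelInKZ.TwoPosets.StuffleProductInKZ :=
  fun s t hs ht hs' ht' => AddSubgroup.closure_mono Set.subset_union_left (h s t hs ht hs' ht')

/-- Stub 3 implies the sibling's `HoffmanDeepInKZ` statement. [folklore] -/
theorem hoffmanDeepInKZ_of_stub (h : ∀ (s : List ℕ), Literature.NumberTheory.Transcendental.MZV.IsAdmissible s → (∑ l : Fin s.length, Summit.KontsevichZagierPeriods.MzvKernelInKZ.TwoPosets.zIdx (s.take l.1 ++ [s.get l + 1] ++ s.drop (l.1 + 1)) 1) - (∑ l : Fin s.length, ∑ j ∈ Finset.range (s.get l - 1), Summit.KontsevichZagierPeriods.MzvKernelInKZ.TwoPosets.zIdx (s.take l.1 ++ [s.get l - j, j + 1] ++ s.drop (l.1 + 1)) 1) ∈ AddSubgroup.closure (Literature.NumberTheory.Transcendental.KZ.domainAddRel ∪ Literature.NumberTheory.Transcendental.KZ.integrandAddRel ∪ Literature.NumberTheory.Transcendental.KZ.changeOfVariablesRel)) :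
    Summit.KontsevichZagierPeriods.MzvKernelInKZ.TwoPosets.HoffmanDeepInKZ :=
  fun s hs _ => AddSubgroup.closure_mono Set.subset_union_left (h s hs)

end Summit.KontsevichZagierPeriods.KontsevichZagierPeriods.Cruxes.MzvScissorsSector.TwoPosetsScissors
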